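import Literature.MathematicalPhysics.QuantumFieldTheory.Balaban1983to89.B3OddVectorLoops
import Literature.MathematicalPhysics.QuantumFieldTheory.Balaban1983to89.B3IndexNetworks

/-!
# `Balaban1983to89.B3OddVectorLoopsVanish` — T. Bałaban, *(Higgs)₂,₃ quantum fields in a finite volume. III. Renormalization*,
Commun. Math. Phys. **88** (1983) 411–445 [Balaban1983Higgs3]: p. 434, *"the expressions corresponding to graphs with an odd
number of external vector field legs (and no other external legs) are equal to 0"* — the internal-index factor of such a graph of
the concrete model `B3Cor23Concrete` VANISHES

statement-level skeleton of published theorems with citation tags; proofs where landed; nothing here is a claim about the Yang–Mills mass gap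

PDF held: `paper:balaban1983-higgs-2-3-quantum-fields-finite-volume` (journal page = PDF page + 410); renders read as images:
`…/b2b-balaban-ref1/pages/1983-cmp88-higgs23-III/1983-cmp88-higgs23-III-p003, p004, p023, p024-x2.png` (pp. 413, 414, 433, 434).
CITATION HEADER (lean-in-tree rule).  lit-balaban TYPED SKELETON (HOME `run/shared/lean/pub/lit-balaban/`), Phase 2, seat p18
(gen 4), unit `lit-balaban-p18`: SKELETON row **B3.Txt@434** (owner r15), p. 434 [PDF 24], verbatim: *"At first let us remark that
the expressions corresponding to graphs with an odd number of external vector field legs (and no other external legs) are equal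
to 0. This follows from the fact that every graph of this type has at least one loop of scalar field lines with an odd number of
vector field legs, thus with an odd power of q, and we have tr q^{2n+1} = 0. Thus we have no divergent subgraphs with one or three
external vector field legs."*  Graph half: `B3OddVectorLoops.exists_odd_loop` (p18 gen 2); algebraic half: r15's
`B3Sect2StatementsPart2.trace_pow_odd_eq_zero_of_transpose_eq_neg`; index/trace evaluation: `B3IndexNetworks` (p18 gen 4).
THIS MODULE closes the sentence on the model: the CONCLUSION *"are equal to 0"* for the internal-index factor of the expression.

THE OBJECT (`indexWeight`).  In the setting of §3 where the sentence is used (p. 433: the constant background field B̃₀ removed by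
a gauge transformation, the propagators replaced by G_k(0), which is the identity in the internal O(N)-indices) the dependence of
the expression of a graph G on the internal indices a = 1, …, N of the scalar field φ′ ∈ ℝ^N factors through one number: the sum
over all assignments of indices to the φ′-legs of G of the product of (i) for every vertex (1.7)–(1.11), whose two φ′-legs sit in
one bilinear form ⟨φ′, q^{n+n′}φ′⟩ (pp. 413–414; n + n′ = all its vector legs, `VertexKind.dv`), the matrix element
(q^{n+n′})_{a a′} of its two legs; for (1.6) = −λη^d(φ′·φ′)(φ′·φ′) the two Kronecker deltas δ_{a₀a₁}δ_{a₂a₃}; (ii) for every scalar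
line the Kronecker delta δ_{aa′} of its two endpoints (`indexWeight_eq`).  It is defined as the value (`B3IndexNetworks.eval`) of
the index network of G whose edges are the strands of `B3OddVectorLoops` (power `vecLegsAt`) and the scalar lines (power 0).
Scope, recorded: for the R-vertices (1.9), (1.11), (1.15) the printed factor q^{n+n̄+1}R_{n̄+1}(qe(L^kε)Ã(·)) is the nominal power
times a power SERIES in qÃ, so `indexWeight` is their leading term only — the sentence is applied in §3 to graphs without
R-vertices (those have D > 0, Cor. 2.3); the vertices (1.13)–(1.15) (one φ′-leg, paired with the external field (1.12)) are
excluded by the printed proviso *"and no other external legs"* (hypothesis `¬ HasVertex1315` below).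

WHAT IS PROVED (sorry-free; no `Prop` fact).  For EVERY graph of the model with all φ′-legs internal, no vertex (1.13)–(1.15), and
every antisymmetric q (N ≥ 1 arbitrary): `indexWeight_eq_zero_of_odd_loop` — a loop of scalar field lines (`loopOf`) carrying an odd
number of vector field legs (`loopVecLegs`) forces `indexWeight G q = 0` (the loop is a closed set of degree-2 nodes of the index
network; `B3IndexNetworks.eval_eq_zero_of_odd_closed`); **`indexWeight_eq_zero_of_odd_extVector`** — an odd number of external
vector field legs (uncontracted A′-legs plus Ã-legs) forces `indexWeight G q = 0` (via `exists_odd_loop`): the printed sentence;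
`indexWeight_eq_zero_of_one_or_three` — the two cases *"one or three external vector field legs"* named in print.  Non-vacuity:
`indexWeight_tadpole17` — the (1.7)-tadpole (one closed scalar line, no vector legs: an even loop) has weight tr q⁰ = N ≠ 0.
-/

namespace Literature.MathematicalPhysics.QuantumFieldTheory.Balaban1983to89.B3OddVectorLoopsVanish

open Finset B3Prop1 B3Sect2Statements B3VertexBridge B3Cor23Concrete B3DivergentGraphs B3OddVectorLoops B3IndexNetworks

variable {nbar : ℕ} (G : Graph nbar)

/-! ## Strand mates and line mates of φ′-legs -/

/-- The strand mate of a φ′-leg: the leg of index 0 ↔ 1, 2 ↔ 3 of the same vertex (the other leg of its bilinear form, pp. 413–414),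
or the leg itself when that index does not exist (vertices (1.13)–(1.15)). [cite: Balaban1983Higgs3, (1.6)–(1.11) p.413] -/
def mateLeg (x : SLeg G) : SLeg G :=
  if h : mateNat x.2 < (G.kind x.1).scalarLegs then ⟨x.1, ⟨mateNat x.2, h⟩⟩ else x

/-- kernel: reading a leg of G as a φ′-leg (A′-legs are sent to a default). [cite: Balaban1983Higgs3, (1.17) p.415] -/
def toSLeg (x : SLeg G) : Leg G.kind → SLeg G
  | ⟨i, .inl j⟩ => ⟨i, j⟩
  | ⟨_, .inr _⟩ => x

/-- The line mate of a φ′-leg: the φ′-leg at the other end of the internal scalar line through it (the leg itself if it is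
external). [cite: Balaban1983Higgs3, p.415] -/
def lineMate (x : SLeg G) : SLeg G := (G.other ⟨x.1, .inl x.2⟩).elim x (toSLeg G x)

/-- An integer key of a φ′-leg (vertex number and leg index), used to orient every scalar line once.
[cite: Balaban1983Higgs3, (1.17) p.415] -/
def key (x : SLeg G) : ℕ := 5 * (x.1 : ℕ) + (x.2 : ℕ)

/-- kernel: two φ′-legs with the same vertex and the same index coincide. [cite: Balaban1983Higgs3, (1.17) p.415] -/
theorem sleg_ext {x y : SLeg G} (h1 : x.1 = y.1) (h2 : (x.2 : ℕ) = y.2) : x = y := by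
  obtain ⟨i, j⟩ := x
  obtain ⟨i', j'⟩ := y
  simp only at h1 h2
  subst h1
  simp only [Sigma.mk.injEq, heq_eq_eq, true_and]
  exact Fin.ext h2

/-- kernel: every catalogue vertex has at most four φ′-legs. [cite: Balaban1983Higgs3, (1.6)–(1.15) pp.413–414] -/
theorem scalarLegs_le_four (v : VertexKind) : v.scalarLegs ≤ 4 := by
  cases v <;> simp [VertexKind.scalarLegs]

/-- kernel: the key determines the leg. [cite: Balaban1983Higgs3, (1.17) p.415] -/
theorem key_injective : Function.Injective (key G) := by
  intro x y h
  have hx : (x.2 : ℕ) < 5 := lt_of_lt_of_le x.2.isLt ((scalarLegs_le_four _).trans (by norm_num))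
  have hy : (y.2 : ℕ) < 5 := lt_of_lt_of_le y.2.isLt ((scalarLegs_le_four _).trans (by norm_num))
  unfold key at h
  exact sleg_ext G (Fin.ext (by omega)) (by omega)

/-- kernel: a vertex not of the form (1.13)–(1.15) has two or four φ′-legs, so every leg index has its strand mate 0 ↔ 1, 2 ↔ 3.
[cite: Balaban1983Higgs3, (1.6)–(1.11) p.413] -/
theorem mateNat_lt (h : ¬ G.HasVertex1315) (x : SLeg G) : mateNat x.2 < (G.kind x.1).scalarLegs := by
  have hk : (G.kind x.1).isOfForm1315 = false := by
    simpa using (not_exists.mp h) x.1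
  have hj := x.2.isLt
  generalize (x.2 : ℕ) = m at hj ⊢
  generalize G.kind x.1 = v at hk hj ⊢
  cases v <;> simp [VertexKind.isOfForm1315, VertexKind.scalarLegs] at hk hj ⊢ <;> unfold mateNat <;> split_ifs <;> omega

/-- kernel: with all strand mates present, `mateLeg` is the strand mate ⟨vertex, 0 ↔ 1 / 2 ↔ 3⟩. [cite: Balaban1983Higgs3, (1.6)–(1.11) p.413] -/
theorem mateLeg_fst (h : ¬ G.HasVertex1315) (x : SLeg G) :
    (mateLeg G x).1 = x.1 ∧ ((mateLeg G x).2 : ℕ) = mateNat x.2 := by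
  have hm := mateNat_lt G h x
  unfold mateLeg
  rw [dif_pos hm]
  exact ⟨rfl, rfl⟩

/-- kernel: the strand pairing of legs is an involution. [cite: Balaban1983Higgs3, (1.6)–(1.11) p.413] -/
theorem mateLeg_mateLeg (h : ¬ G.HasVertex1315) (x : SLeg G) : mateLeg G (mateLeg G x) = x := by
  obtain ⟨h1, h2⟩ := mateLeg_fst G h (mateLeg G x)
  obtain ⟨h1', h2'⟩ := mateLeg_fst G h x
  exact sleg_ext G (h1.trans h1') (by rw [h2, h2', mateNat_mateNat])

/-- kernel: a leg and its strand mate are adjacent in the sense of `B3OddVectorLoops.Adj` (same bilinear form), both ways.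
[cite: Balaban1983Higgs3, p.434] -/
theorem adj_mateLeg (h : ¬ G.HasVertex1315) (x : SLeg G) : Adj G x (mateLeg G x) ∧ Adj G (mateLeg G x) x := by
  obtain ⟨h1, h2⟩ := mateLeg_fst G h x
  exact ⟨Or.inr ⟨h1.symm, h2⟩, Or.inr ⟨h1, by rw [h2, mateNat_mateNat]⟩⟩

/-- kernel: if G has no external φ′-legs, every φ′-leg lies on an internal scalar line. [cite: Balaban1983Higgs3, p.414] -/
theorem isSome_of_numExtScalarLegs (hint : numExtScalarLegs G = 0) (x : SLeg G) : (G.other ⟨x.1, .inl x.2⟩).isSome := by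
  have h0 : (G.kind x.1).scalarLegs - G.intScalar x.1 = 0 :=
    (Finset.sum_eq_zero_iff.mp hint) x.1 (mem_univ _)
  have hle := G.intScalar_le x.1
  have hcard : (univ.filter fun j : Fin (G.kind x.1).scalarLegs => (G.other ⟨x.1, .inl j⟩).isSome).card =
      (univ : Finset (Fin (G.kind x.1).scalarLegs)).card := by
    rw [card_univ, Fintype.card_fin]; unfold Graph.intScalar at h0 hle; omega
  exact (Finset.card_filter_eq_iff.mp hcard) x.2 (mem_univ _)

/-- kernel: for an internal φ′-leg, «the other endpoint» is its line mate. [cite: Balaban1983Higgs3, p.415] -/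
theorem other_eq_lineMate {x : SLeg G} (hx : (G.other ⟨x.1, .inl x.2⟩).isSome) :
    G.other ⟨x.1, .inl x.2⟩ = some ⟨(lineMate G x).1, .inl (lineMate G x).2⟩ := by
  obtain ⟨y, hy⟩ := Option.isSome_iff_exists.mp hx
  obtain ⟨i', j', rfl, -⟩ := G.other_scalar hy
  have hl : lineMate G x = ⟨i', j'⟩ := by
    unfold lineMate; rw [hy]; rfl
  rw [hy, hl]

/-- kernel: the line pairing of internal φ′-legs is a fixed-point-free involution. [cite: Balaban1983Higgs3, p.415] -/
theorem lineMate_lineMate {x : SLeg G} (hx : (G.other ⟨x.1, .inl x.2⟩).isSome) :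
    lineMate G (lineMate G x) = x ∧ lineMate G x ≠ x := by
  have h1 := other_eq_lineMate G hx
  have h2 := G.other_symm _ _ h1
  refine ⟨?_, fun heq => G.other_ne _ _ h1 (by rw [heq])⟩
  show (G.other ⟨(lineMate G x).1, .inl (lineMate G x).2⟩).elim (lineMate G x) (toSLeg G (lineMate G x)) = x
  rw [h2]
  rfl

/-- kernel: an internal φ′-leg and its line mate are adjacent in the sense of `B3OddVectorLoops.Adj` (joined by a line), both ways.
[cite: Balaban1983Higgs3, p.434] -/
theorem adj_lineMate {x : SLeg G} (hx : (G.other ⟨x.1, .inl x.2⟩).isSome) :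
    Adj G x (lineMate G x) ∧ Adj G (lineMate G x) x :=
  ⟨Or.inl (other_eq_lineMate G hx), Or.inl (G.other_symm _ _ (other_eq_lineMate G hx))⟩

/-! ## The index network and the index weight of a graph -/

/-- The φ′-legs opening a strand: even leg index with an existing strand mate (one per bilinear form; two for (1.6)).
[cite: Balaban1983Higgs3, (1.6)–(1.11) p.413] -/
def strandSrc : Finset (SLeg G) := univ.filter fun x => (x.2 : ℕ) % 2 = 0 ∧ mateNat x.2 < (G.kind x.1).scalarLegs

/-- The φ′-legs opening a scalar line: internal legs with the smaller key of the two endpoints (one per line).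
[cite: Balaban1983Higgs3, p.415] -/
def lineSrc : Finset (SLeg G) := univ.filter fun x => (G.other ⟨x.1, .inl x.2⟩).isSome ∧ key G x < key G (lineMate G x)

/-- The strand edges of the index network of G: one edge per bilinear form, from its leg of even index to its strand mate,
carrying the power q^{n+n′} (`vecLegsAt`: n + n′ on the form of (1.7)–(1.11), 0 on the two forms of (1.6)).
[cite: Balaban1983Higgs3, (1.6)–(1.11) p.413] -/
def strandEdges : Multiset (Edge (SLeg G)) := (strandSrc G).val.map fun x => ⟨x, mateLeg G x, 1, vecLegsAt G x⟩

/-- The line edges of the index network of G: one edge per internal scalar line, carrying δ_{aa′} = q⁰ (the propagator G_k(0) is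
the identity in the internal indices). [cite: Balaban1983Higgs3, p.433] -/
def lineEdges : Multiset (Edge (SLeg G)) := (lineSrc G).val.map fun x => ⟨x, lineMate G x, 1, 0⟩

/-- The index network of G (strands and scalar lines). [cite: Balaban1983Higgs3, p.434] -/
def indexNet : Multiset (Edge (SLeg G)) := strandEdges G + lineEdges G

variable {n : Type*} [Fintype n] [DecidableEq n]

/-- The internal-index weight of the graph G for the charge matrix q (N = |n| components): the sum over all assignments of
internal indices to the φ′-legs of G of the product of the matrix elements (q^{n+n′})_{aa′} of the bilinear forms of the vertices
and the Kronecker deltas of the scalar lines — for a graph all of whose φ′-legs are internal, the factor through which its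
expression depends on the internal indices at zero background field (module docstring; for external φ′-legs the indices would
be summed as well — not used). [cite: Balaban1983Higgs3, p.434] -/
noncomputable def indexWeight (q : Matrix n n ℝ) : ℝ := eval q (indexNet G)

/-- kernel: `indexWeight` unfolded — Σ_{a : legs → indices} Π_{forms} (q^{n+n′})(a x, a x′) · Π_{lines} δ(a x, a x′).
[cite: Balaban1983Higgs3, p.434] -/
theorem indexWeight_eq (q : Matrix n n ℝ) : indexWeight G q = ∑ a : SLeg G → n,
    (∏ x ∈ strandSrc G, (q ^ vecLegsAt G x) (a x) (a (mateLeg G x))) *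
      ∏ x ∈ lineSrc G, (1 : Matrix n n ℝ) (a x) (a (lineMate G x)) := by
  simp only [indexWeight, eval, weight, indexNet, strandEdges, lineEdges, Multiset.map_add, Multiset.prod_add,
    Multiset.map_map, Function.comp_def, Edge.mat, Int.cast_one, one_smul, pow_zero, Finset.prod_eq_multiset_prod]

/-! ## The hypotheses of the contraction theorem on the model -/

omit [Fintype n] [DecidableEq n] in
/-- kernel: edge-ends add over a union of networks. [cite: Balaban1983Higgs3, p.434] -/
theorem deg_add (L L' : Multiset (Edge (SLeg G))) (y : SLeg G) : deg (L + L') y = deg L y + deg L' y := by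
  unfold deg; rw [Multiset.countP_add, Multiset.countP_add]; ring

omit [Fintype n] [DecidableEq n] in
/-- kernel: a family of edges x → σ x indexed by the sources of a pairing σ (an involution of the legs such that exactly one of
x, σ x is a source) meets every leg exactly once. [cite: Balaban1983Higgs3, p.434] -/
theorem deg_pairEdges (σ : SLeg G → SLeg G) (hσ : Function.Involutive σ) (src : SLeg G → Prop) [DecidablePred src]
    (hsrc : ∀ x, src x ↔ ¬ src (σ x)) (c : ℤ) (m : SLeg G → ℕ) (y : SLeg G) :
    deg ((univ.filter src).val.map fun x => (⟨x, σ x, c, m x⟩ : Edge (SLeg G))) y = 1 := by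
  simp only [deg, Multiset.countP_map, ← Finset.filter_val, Finset.card_val, Finset.filter_filter]
  by_cases hy : src y
  · have h1 : (univ.filter fun x => src x ∧ x = y) = {y} := by
      ext x; simp only [mem_filter, mem_univ, true_and, mem_singleton]
      exact ⟨fun h => h.2, fun h => ⟨h ▸ hy, h⟩⟩
    have h2 : (univ.filter fun x => src x ∧ σ x = y) = ∅ := by
      refine filter_eq_empty_iff.mpr fun x _ h => ?_
      have hx : x = σ y := by rw [← h.2, hσ x]
      exact (hsrc y).mp hy (hx ▸ h.1)
    rw [h1, h2, card_singleton, card_empty]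
  · have hσy : src (σ y) := by_contra fun h' => hy ((hsrc y).mpr h')
    have h1 : (univ.filter fun x => src x ∧ x = y) = ∅ :=
      filter_eq_empty_iff.mpr fun x _ h => hy (h.2 ▸ h.1)
    have h2 : (univ.filter fun x => src x ∧ σ x = y) = {σ y} := by
      ext x; simp only [mem_filter, mem_univ, true_and, mem_singleton]
      exact ⟨fun h => by rw [← h.2, hσ x], fun h => by subst h; exact ⟨hσy, hσ y⟩⟩
    rw [h1, h2, card_singleton, card_empty]

/-- kernel: with all strand mates present, exactly one leg of each strand has even index. [cite: Balaban1983Higgs3, (1.6)–(1.11) p.413] -/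
theorem strandPred_iff (h : ¬ G.HasVertex1315) (x : SLeg G) :
    ((x.2 : ℕ) % 2 = 0 ∧ mateNat x.2 < (G.kind x.1).scalarLegs) ↔
      ¬ (((mateLeg G x).2 : ℕ) % 2 = 0 ∧ mateNat (mateLeg G x).2 < (G.kind (mateLeg G x).1).scalarLegs) := by
  obtain ⟨hf, hs⟩ := mateLeg_fst G h x
  rw [hs, hf, mateNat_mateNat]
  have h1 := mateNat_lt G h x
  have h3 := x.2.isLt
  simp only [h1, h3, and_true]
  unfold mateNat; split_ifs <;> omega

/-- kernel: with all φ′-legs internal, exactly one endpoint of each scalar line has the smaller key. [cite: Balaban1983Higgs3, p.415] -/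
theorem linePred_iff (hint : numExtScalarLegs G = 0) (x : SLeg G) :
    ((G.other ⟨x.1, .inl x.2⟩).isSome ∧ key G x < key G (lineMate G x)) ↔
      ¬ ((G.other ⟨(lineMate G x).1, .inl (lineMate G x).2⟩).isSome ∧
          key G (lineMate G x) < key G (lineMate G (lineMate G x))) := by
  have hx := isSome_of_numExtScalarLegs G hint x
  have hx' := isSome_of_numExtScalarLegs G hint (lineMate G x)
  obtain ⟨hll, hne⟩ := lineMate_lineMate G hx
  rw [hll]
  have hk : key G x ≠ key G (lineMate G x) := fun hk => hne (key_injective G hk).symm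
  simp only [hx, hx', true_and]
  omega

/-- kernel: in a graph with all φ′-legs internal and no vertex (1.13)–(1.15) every φ′-leg is met by exactly TWO edge-ends of the
index network — its bilinear form and its scalar line (the loops of scalar lines are closed). [cite: Balaban1983Higgs3, p.434] -/
theorem deg_indexNet (h : ¬ G.HasVertex1315) (hint : numExtScalarLegs G = 0) (y : SLeg G) : deg (indexNet G) y = 2 := by
  have hs : deg (strandEdges G) y = 1 :=
    deg_pairEdges G (mateLeg G) (mateLeg_mateLeg G h) _ (strandPred_iff G h) 1 (vecLegsAt G) y
  have hl : deg (lineEdges G) y = 1 :=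
    deg_pairEdges G (lineMate G) (fun x => (lineMate_lineMate G (isSome_of_numExtScalarLegs G hint x)).1) _
      (linePred_iff G hint) 1 (fun _ => 0) y
  rw [indexNet, deg_add, hs, hl]

/-- kernel: a loop of scalar field lines (`B3OddVectorLoops.loopOf`) is closed under the edges of the index network (strands and
lines). [cite: Balaban1983Higgs3, p.434] -/
theorem closed_indexNet (h : ¬ G.HasVertex1315) (hint : numExtScalarLegs G = 0) (x₀ : SLeg G) :
    ∀ e ∈ indexNet G, (e.src ∈ loopOf G x₀ ↔ e.tgt ∈ loopOf G x₀) := by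
  intro e he
  unfold indexNet at he
  rcases Multiset.mem_add.mp he with he | he
  · obtain ⟨x, -, rfl⟩ := Multiset.mem_map.mp he
    obtain ⟨h1, h2⟩ := adj_mateLeg G h x
    exact ⟨fun hx => loopOf_closed G hx h1, fun hx => loopOf_closed G hx h2⟩
  · obtain ⟨x, -, rfl⟩ := Multiset.mem_map.mp he
    obtain ⟨h1, h2⟩ := adj_lineMate G (isSome_of_numExtScalarLegs G hint x)
    exact ⟨fun hx => loopOf_closed G hx h1, fun hx => loopOf_closed G hx h2⟩

/-- kernel: the total power of q carried by the edges inside a loop is its number of vector field legs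
(`B3OddVectorLoops.loopVecLegs`). [cite: Balaban1983Higgs3, p.434] -/
theorem powIn_indexNet (h : ¬ G.HasVertex1315) (x₀ : SLeg G) : powIn (indexNet G) (loopOf G x₀) = loopVecLegs G x₀ := by
  have hl : powIn (lineEdges G) (loopOf G x₀) = 0 := Multiset.sum_eq_zero fun v hv => by
    obtain ⟨e, he, rfl⟩ := Multiset.mem_map.mp hv
    obtain ⟨x, -, rfl⟩ := Multiset.mem_map.mp he
    simp
  have hs : powIn (strandEdges G) (loopOf G x₀) = ∑ x ∈ strandSrc G, if x ∈ loopOf G x₀ then vecLegsAt G x else 0 := by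
    simp only [powIn, strandEdges, Multiset.map_map, Function.comp_def, Finset.sum_eq_multiset_sum]
  have hadd : powIn (indexNet G) (loopOf G x₀) = powIn (strandEdges G) (loopOf G x₀) + powIn (lineEdges G) (loopOf G x₀) := by
    simp [powIn, indexNet, Multiset.map_add, Multiset.sum_add]
  rw [hadd, hl, add_zero, hs, Finset.sum_ite_mem, Finset.inter_comm, ← Finset.sum_ite_mem]
  unfold loopVecLegs
  refine Finset.sum_congr rfl fun x _ => ?_
  by_cases hx : x ∈ strandSrc G
  · rw [if_pos hx]
  · rw [if_neg hx]
    have h0 : (x.2 : ℕ) ≠ 0 := fun h0 => hx (mem_filter.mpr ⟨mem_univ _, by omega, mateNat_lt G h x⟩)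
    rw [vecLegsAt, if_neg h0]

/-! ## The vanishing of the index weight -/

/-- **p. 434** [PDF 24], on the model: *"every graph of this type has at least one loop of scalar field lines with an odd number
of vector field legs, thus with an odd power of q, and we have tr q^{2n+1} = 0"* ⇒ the expression vanishes — for EVERY graph of
`B3Cor23Concrete` with all φ′-legs internal and no vertex (1.13)–(1.15), every N ≥ 1 and every antisymmetric charge matrix q:
a loop of scalar field lines (`B3OddVectorLoops.loopOf`) with an odd number of vector field legs (`loopVecLegs`) forces the
internal-index weight of the graph to be 0. [cite: Balaban1983Higgs3, p.434] -/
theorem indexWeight_eq_zero_of_odd_loop [Nonempty n] (q : Matrix n n ℝ) (hq : q.transpose = -q)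
    (h : ¬ G.HasVertex1315) (hint : numExtScalarLegs G = 0) (x₀ : SLeg G) (hodd : Odd (loopVecLegs G x₀)) :
    indexWeight G q = 0 :=
  eval_eq_zero_of_odd_closed q hq (indexNet G) (loopOf G x₀) (closed_indexNet G h hint x₀)
    (fun y _ => deg_indexNet G h hint y) (by rw [powIn_indexNet G h x₀]; exact hodd)

/-- **p. 434** [PDF 24], verbatim: *"the expressions corresponding to graphs with an odd number of external vector field legs
(and no other external legs) are equal to 0"* — PROVED for the internal-index weight of every graph of the model
`B3Cor23Concrete` whose number of external vector field legs (uncontracted A′-legs plus Ã-legs) is odd and which has no other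
external legs (all φ′-legs internal, no vertex (1.13)–(1.15)), for every N ≥ 1 and every antisymmetric q: by
`B3OddVectorLoops.exists_odd_loop` and `indexWeight_eq_zero_of_odd_loop`. [cite: Balaban1983Higgs3, p.434] -/
theorem indexWeight_eq_zero_of_odd_extVector [Nonempty n] (q : Matrix n n ℝ) (hq : q.transpose = -q)
    (h : ¬ G.HasVertex1315) (hint : numExtScalarLegs G = 0) (hodd : Odd (numExtVectorLegs G + numTildeLegs G)) :
    indexWeight G q = 0 := by
  obtain ⟨x₀, hx₀⟩ := exists_odd_loop G hodd
  exact indexWeight_eq_zero_of_odd_loop G q hq h hint x₀ hx₀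

/-- **p. 434** [PDF 24], the two cases named in print (*"Thus we have no divergent subgraphs with one or three external vector
field legs"*): a graph of the model with exactly one or exactly three external vector field legs and no other external legs has
internal-index weight 0, for every N ≥ 1 and every antisymmetric q. [cite: Balaban1983Higgs3, p.434] -/
theorem indexWeight_eq_zero_of_one_or_three [Nonempty n] (q : Matrix n n ℝ) (hq : q.transpose = -q)
    (h : ¬ G.HasVertex1315) (hint : numExtScalarLegs G = 0)
    (h13 : numExtVectorLegs G + numTildeLegs G = 1 ∨ numExtVectorLegs G + numTildeLegs G = 3) : indexWeight G q = 0 := by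
  obtain ⟨x₀, hx₀⟩ := exists_odd_loop_of_one_or_three G h13
  exact indexWeight_eq_zero_of_odd_loop G q hq h hint x₀ hx₀

/-! ## Non-vacuity on the model: the closed scalar loop of the (1.7)-tadpole contributes tr 1 = N -/

open B3Cor23ConcreteProof in
/-- kernel: the index network of the (1.7)-tadpole (`B3Cor23ConcreteProof.tadpole17`: one vertex (1.7), its two φ′-legs joined) —
the strand of the form ⟨φ′, q⁰φ′⟩ and the line, both from the leg 0 to the leg 1. [cite: Balaban1983Higgs3, p.434] -/
theorem indexNet_tadpole17 (nbar : ℕ) :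
    indexNet (tadpole17 nbar) =
      (⟨⟨⟨0, Nat.one_pos⟩, ⟨0, Nat.succ_pos 1⟩⟩, ⟨⟨0, Nat.one_pos⟩, ⟨1, Nat.lt_succ_self 1⟩⟩, 1, 0⟩ : Edge (SLeg (tadpole17 nbar))) ::ₘ
        (⟨⟨⟨0, Nat.one_pos⟩, ⟨0, Nat.succ_pos 1⟩⟩, ⟨⟨0, Nat.one_pos⟩, ⟨1, Nat.lt_succ_self 1⟩⟩, 1, 0⟩ : Edge (SLeg (tadpole17 nbar))) ::ₘ 0 := by
  rfl

open B3Cor23ConcreteProof in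
/-- kernel: the (1.7)-tadpole has two φ′-legs. [cite: Balaban1983Higgs3, (1.7) p.413] -/
theorem card_sleg_tadpole17 (nbar : ℕ) : Fintype.card (SLeg (tadpole17 nbar)) = 2 := by
  rfl

open B3Cor23ConcreteProof in
/-- Non-vacuity of `indexWeight` on the model: the (1.7)-tadpole — a closed loop of ONE scalar line with NO vector field legs (an
even power, q⁰) — has internal-index weight tr q⁰ = N ≠ 0 (the familiar factor N of a closed scalar loop), for every N ≥ 1 and
every antisymmetric q; computed by the contraction identities of `B3IndexNetworks` (reverse, contract, trace off).  So the parity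
hypothesis in the theorems above is what makes the weight vanish. [cite: Balaban1983Higgs3, p.434] -/
theorem indexWeight_tadpole17 [Nonempty n] (nbar : ℕ) (q : Matrix n n ℝ) (hq : q.transpose = -q) :
    indexWeight (tadpole17 nbar) q = Fintype.card n := by
  have hcard : (Fintype.card n : ℝ) ≠ 0 := Nat.cast_ne_zero.mpr Fintype.card_ne_zero
  set x0 : SLeg (tadpole17 nbar) := ⟨⟨0, Nat.one_pos⟩, ⟨0, Nat.succ_pos 1⟩⟩ with hx0
  set x1 : SLeg (tadpole17 nbar) := ⟨⟨0, Nat.one_pos⟩, ⟨1, Nat.lt_succ_self 1⟩⟩ with hx1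
  set e : Edge (SLeg (tadpole17 nbar)) := ⟨x0, x1, 1, 0⟩ with he
  have hne : x0 ≠ x1 := fun h => absurd (congrArg (fun x : SLeg (tadpole17 nbar) => (x.2 : ℕ)) h) (by norm_num [hx0, hx1])
  have hnet : indexNet (tadpole17 nbar) = e ::ₘ e ::ₘ 0 := indexNet_tadpole17 nbar
  have h0 : ∀ f ∈ (0 : Multiset (Edge (SLeg (tadpole17 nbar)))), f.src ≠ x1 ∧ f.tgt ≠ x1 :=
    fun f hf => absurd hf (Multiset.notMem_zero f)
  have h0' : ∀ f ∈ (0 : Multiset (Edge (SLeg (tadpole17 nbar)))), f.src ≠ x0 ∧ f.tgt ≠ x0 :=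
    fun f hf => absurd hf (Multiset.notMem_zero f)
  -- reverse the second copy, contract x1, trace off the resulting self-loop at x0
  have h1 : eval q (e ::ₘ e ::ₘ 0) = eval q (e ::ₘ e.flip ::ₘ 0) := by
    rw [Multiset.cons_swap e e.flip, eval_flip q hq, Multiset.cons_swap]
  have h2 := eval_merge q e e.flip 0 (p' := x1) rfl rfl hne hne h0
  have h3 := eval_loop q (e.merge e.flip) 0 (p' := x0) rfl rfl h0'
  have hmat : (e.merge e.flip).mat q = 1 := by simp [Edge.merge, Edge.flip, Edge.mat, he]
  have hempty : eval q (0 : Multiset (Edge (SLeg (tadpole17 nbar)))) = (Fintype.card n : ℝ) ^ 2 := by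
    simp only [eval, weight, Multiset.map_zero, Multiset.prod_zero, Finset.sum_const, Finset.card_univ, nsmul_eq_mul,
      mul_one, Fintype.card_fun, card_sleg_tadpole17, Nat.cast_pow]
  rw [hmat, Matrix.trace_one, hempty] at h3
  unfold indexWeight
  rw [hnet, h1]
  have h4 : (Fintype.card n : ℝ) * ((Fintype.card n : ℝ) * eval q (e ::ₘ e.flip ::ₘ 0)) =
      (Fintype.card n : ℝ) * (Fintype.card n : ℝ) ^ 2 := by rw [h2, h3]
  have h5 : (Fintype.card n : ℝ) * eval q (e ::ₘ e.flip ::ₘ 0) = (Fintype.card n : ℝ) ^ 2 :=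
    mul_left_cancel₀ hcard h4
  exact mul_left_cancel₀ hcard (h5.trans (sq _))

end Literature.MathematicalPhysics.QuantumFieldTheory.Balaban1983to89.B3OddVectorLoopsVanish
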